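import Summits.CriticalPhenomena.SAWScalingLimit.Theorems.SAWRenewalTightnessAnnularMassDecayFirstDescentFactorisation
import Summits.CriticalPhenomena.SAWScalingLimit.Theorems.SAWRenewalTightnessAnnularMassDecayChainStructure
import Summits.CriticalPhenomena.SAWScalingLimit.Theorems.SAWRenewalTightnessAnnularMassDecayLastRenewalCut
import Literature.Probability.RandomPlanarGeometry.UniformSAWCurveLaw

/-!
# The last-renewal cut of the chain-stopped mass, II: the identity and the mass balance

Line `radial-renewal-kesten-inequality` of the crux `AnnularMassDecay` (stmt-CriticalPhenomena-4729),
support for the OPEN stub S2 `stub_deathSeed` (`∃ A > 1, ε > 0, D(u; ρ_u/A)[N] ≤ 1 - ε`).  Notation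
as in `…LastRenewalCut.lean`: `ρ_v = dist (Site.toComplex v) z`, `D(u;s)[N]` the `x_c`-mass of the
chain-stopped family at level `s` from `u`, `N₀(u,z) = (2⌈ρ_u⌉₊ + 3)²` the stabilisation
threshold of `rr_cb_stable` (members are short, `rr_cb_length_le`).  A RECORD-ENDING prefix is an
`m`-step self-avoiding `η` from `u` (`m = 0` allowed) confined to the open disc of radius `ρ_u`
after time `0` whose end is a strict radial record; `k(w)[N]` is the mass of the radially
IRREDUCIBLE descents from `w` (length `0 < k ≤ N`, confined to the open disc of radius `ρ_w` after
time `0`, end = strict record of radius `≤ ρ_w`, no radial renewal time at all: the level-`ρ_w`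
family from `w`), and `Irr_{≤ s}(w)[N]`, `Irr_{> s}(w)[N]` its parts with end radius `≤ s`, `> s`.
All sums are spelled out over `SAW.Zd.saws`, `SAW.criticalFugacity`, `Site.toComplex`; no
definitions here.  Proved in this file, for `s < ρ_u` and `N ≥ N₀(u,z)`:

* `rr_lr_cut_identity` — the last-renewal cut for an arbitrary predicate `Q` on the end radius:
  the mass of the level-`s` members with end predicate `Q` equals
  `Σ_{η record-ending, ρ(end) > s} x_c^{|η|} · (mass of irreducible descents from the end of η
  with end predicate Q)` (`rr_lr_abstract_bijection` fed with the profile lemmas of part I, the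
  S4 walk lemmas `rr_fd_prefix_mem_saws`, `rr_fd_suffix_mem_saws`, and `SAW.Zd.concatWalk_mem_saws`,
  `SAW.Zd.headPart_concatWalk`, `SAW.Zd.tailPart_concatWalk`, `SAW.Zd.concatWalk_headPart_tailPart`);
* `rr_lr_lastRenewal_identity` (registered helper) — `Q = (· ≤ s)`:
  `D(u;s)[N] = Σ_η x_c^{|η|} · Irr_{≤ s}(u + η_m)[N]`;
* `rr_lr_mass_balance` (registered helper) — `D(u;s)[N] = 1 + Σ_η x_c^{|η|} · (k(u + η_m)[N] - 1)`:
  by the renewal equation of the record-ending prefixes (`Q = (s < ·)`: a record-ending prefix of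
  positive length is a shorter one followed by an irreducible descent landing at radius `> s`),
  the split `k = Irr_{≤ s} + Irr_{> s}` and the value `1` of the trivial prefix.

So S2 (`D(u;ρ_u/A) ≤ 1 - ε`) is exactly a statement about the accumulated deficits `1 - k(w)`
along the radial renewal chain.  Sources: H. Kesten, J. Math. Phys. 4 (1963); N. Madras, G. Slade,
*The Self-Avoiding Walk* (1993) §1.2, §4.2. [folklore]
-/

noncomputable section

namespace Summit.CriticalPhenomena.SAWScalingLimit.Theorems.AnnularMassDecay.Radial

open scoped BigOperators Classical
open Literature.Probability.LatticeModels Literature.Probability.RandomPlanarGeometry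

/-! ### The last-renewal cut, for an arbitrary end predicate -/

/-- **The last-renewal cut identity.**  For a predicate `Q` on the end radius, a centre `z`, a start
`u`, a level `s < dist (Site.toComplex u) z` and `N ≥ (2⌈dist (Site.toComplex u) z⌉₊ + 3)²`: the
`x_c`-mass of the `n`-step self-avoiding walks from `u` (`0 < n ≤ N`) confined to the open disc of
radius `dist (Site.toComplex u) z` after time `0`, ending at a strict radial record whose radius
satisfies `Q`, all of whose radial renewal times `0 < t < n` have radius `> s`, equals
`Σ_{m ≤ N} Σ_η x_c^m · Σ_{k ≤ N} Σ_τ x_c^k`, `η` over the record-ending confined `m`-step prefixes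
from `u` with end radius `> s` and `τ` over the radially irreducible descents of length `k` from
`u + η m` whose end radius satisfies `Q`: cut at the last renewal time (or at `0`), glue back by
`SAW.Zd.concatWalk`. [folklore] -/
theorem rr_lr_cut_identity (Q : ℝ → Prop) (z : ℂ) (u : Site 2) (s : ℝ) (N : ℕ)
    (hs : s < dist (Site.toComplex u) z) (hN : (2 * ⌈dist (Site.toComplex u) z⌉₊ + 3) ^ 2 ≤ N) :
    (∑ n ∈ Finset.range (N + 1),
      ∑ _ω ∈ (SAW.Zd.saws 2 n).filter (fun ω =>
        0 < n ∧
        (∀ i, 0 < i → i ≤ n → dist (Site.toComplex (u + ω i)) z < dist (Site.toComplex u) z) ∧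
        (∀ i, i < n → dist (Site.toComplex (u + ω n)) z < dist (Site.toComplex (u + ω i)) z) ∧
        Q (dist (Site.toComplex (u + ω n)) z) ∧
        (∀ t, 0 < t → t < n →
          (∀ i, i < t → dist (Site.toComplex (u + ω t)) z < dist (Site.toComplex (u + ω i)) z) →
          (∀ j, t < j → j ≤ n → dist (Site.toComplex (u + ω j)) z < dist (Site.toComplex (u + ω t)) z) →
          s < dist (Site.toComplex (u + ω t)) z)),
        SAW.criticalFugacity ^ n) =
    ∑ m ∈ Finset.range (N + 1),
      ∑ η ∈ (SAW.Zd.saws 2 m).filter (fun η =>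
          s < dist (Site.toComplex (u + η m)) z ∧
          (∀ i, 0 < i → i ≤ m → dist (Site.toComplex (u + η i)) z < dist (Site.toComplex u) z) ∧
          (∀ i, i < m → dist (Site.toComplex (u + η m)) z < dist (Site.toComplex (u + η i)) z)),
        SAW.criticalFugacity ^ m *
          (∑ k ∈ Finset.range (N + 1),
            ∑ _τ ∈ (SAW.Zd.saws 2 k).filter (fun τ =>
              Q (dist (Site.toComplex (u + η m + τ k)) z) ∧
              0 < k ∧
              (∀ i, 0 < i → i ≤ k →
                dist (Site.toComplex (u + η m + τ i)) z < dist (Site.toComplex (u + η m)) z) ∧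
              (∀ i, i < k →
                dist (Site.toComplex (u + η m + τ k)) z < dist (Site.toComplex (u + η m + τ i)) z) ∧
              dist (Site.toComplex (u + η m + τ k)) z ≤ dist (Site.toComplex (u + η m)) z ∧
              (∀ t, 0 < t → t < k →
                (∀ i, i < t →
                  dist (Site.toComplex (u + η m + τ t)) z < dist (Site.toComplex (u + η m + τ i)) z) →
                (∀ j, t < j → j ≤ k →
                  dist (Site.toComplex (u + η m + τ j)) z < dist (Site.toComplex (u + η m + τ t)) z) →
                dist (Site.toComplex (u + η m)) z < dist (Site.toComplex (u + η m + τ t)) z)),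
              SAW.criticalFugacity ^ k) := by
  refine rr_lr_abstract_bijection (α := ℕ → Site 2) SAW.criticalFugacity N (SAW.Zd.saws 2) _ _ _
    (fun n ω t => 0 < t ∧ t < n ∧
      (∀ i, i < t → dist (Site.toComplex (u + ω t)) z < dist (Site.toComplex (u + ω i)) z) ∧
      (∀ j, t < j → j ≤ n → dist (Site.toComplex (u + ω j)) z < dist (Site.toComplex (u + ω t)) z))
    (fun _ ω t => fun i => ω (min i t)) (fun n ω t => fun i => ω (t + min i (n - t)) - ω t)
    (fun m η σ => SAW.Zd.concatWalk m η σ) ?_ ?_ ?_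
  · -- members are short
    intro n ω hω hC
    exact (rr_cb_length_le hω hC.2.1).trans hN
  · -- the cut at the last renewal time `t` (or `t = 0`)
    intro n ω t hω hC htn hgood hno
    obtain ⟨hn, hconf, hend, hQ, hren⟩ := hC
    have h0 : dist (Site.toComplex (u + ω 0)) z = dist (Site.toComplex u) z := by
      rw [(SAW.Zd.mem_saws.1 hω).1, add_zero]
    obtain ⟨htn', hrec, hfut, hst⟩ :=
      rr_lr_profile_cutTime (r := fun k => dist (Site.toComplex (u + ω k)) z) h0 hs hn hconf hren hgood
    refine ⟨rr_fd_prefix_mem_saws hω htn, ?_, rr_fd_suffix_mem_saws hω htn, ?_, ?_⟩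
    · exact rr_lr_profile_prefix (r := fun k => dist (Site.toComplex (u + ω k)) z)
        (r' := fun i => dist (Site.toComplex (u + ω (min i t))) z) hconf htn hrec hst
        (fun i hi => by simp only [min_eq_left hi])
    · exact rr_lr_profile_suffix Q (r := fun k => dist (Site.toComplex (u + ω k)) z)
        (r'' := fun i => dist (Site.toComplex (u + ω (min t t) + (ω (t + min i (n - t)) - ω t))) z)
        (ρw := dist (Site.toComplex (u + ω (min t t))) z) hend hQ htn' hrec hfut hno
        (by simp only [min_self])
        (fun i hi => by simp only [min_self, min_eq_left hi, add_add_sub_cancel])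
    · have hω' : ω ∈ SAW.Zd.saws 2 (t + (n - t)) := by rwa [Nat.add_sub_of_le htn]
      exact SAW.Zd.concatWalk_headPart_tailPart hω'
  · -- the concatenation of a record-ending prefix `η` and an irreducible descent `σ`
    intro m η k σ hη hP hσ hC'
    obtain ⟨hs', hconfη, hendη⟩ := hP
    obtain ⟨hQ, hk, hconfσ, hendσ, -, hrenσ⟩ := hC'
    have hη0 : dist (Site.toComplex (u + η 0)) z = dist (Site.toComplex u) z := by
      rw [(SAW.Zd.mem_saws.1 hη).1, add_zero]
    have h1 : ∀ i, i ≤ m → SAW.Zd.concatWalk m η σ i = η i := fun i hi => if_pos hi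
    have h2 : ∀ i, u + SAW.Zd.concatWalk m η σ (m + i) = u + η m + σ i := by
      intro i
      rcases Nat.eq_zero_or_pos i with rfl | hi
      · rw [(SAW.Zd.mem_saws.1 hσ).1, add_zero, add_zero, h1 m le_rfl]
      · rw [add_assoc]
        exact congrArg (u + ·) ((if_neg (by omega)).trans (by rw [Nat.add_sub_cancel_left]))
    have hprof := rr_lr_profile_concat Q (rη := fun i => dist (Site.toComplex (u + η i)) z)
      (rσ := fun i => dist (Site.toComplex (u + η m + σ i)) z)
      (rω := fun i => dist (Site.toComplex (u + SAW.Zd.concatWalk m η σ i)) z)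
      hη0 hconfη hendη hs' hk hconfσ hendσ hQ hrenσ (fun i hi => by simp only [h1 i hi])
      (fun i _ => by simp only [h2 i])
    refine ⟨?_, hprof.1, hprof.2.1, hprof.2.2, SAW.Zd.headPart_concatWalk hη σ, ?_⟩
    · -- self-avoiding: `η` stays at radius `≥ ρ_w`, `σ` after time `0` is inside radius `ρ_w`
      refine SAW.Zd.concatWalk_mem_saws hη hσ fun i him j hj1 hjk heq => ?_
      have hlt := hconfσ j hj1 hjk
      rw [add_assoc, ← heq] at hlt
      rcases him.lt_or_eq with hi | rfl
      · exact lt_asymm hlt (hendη i hi)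
      · exact lt_irrefl _ hlt
    · show (fun i => SAW.Zd.concatWalk m η σ (m + min i (m + k - m)) - SAW.Zd.concatWalk m η σ m) = σ
      rw [Nat.add_sub_cancel_left]
      exact SAW.Zd.tailPart_concatWalk η hσ

/-! ### The last-renewal identity -/

/-- **The last-renewal identity** (registered helper `rr_lr_lastRenewal_identity` for
`stub_deathSeed`).  For a centre `z`, a start `u`, a level `s < dist (Site.toComplex u) z` and
`N ≥ (2⌈dist (Site.toComplex u) z⌉₊ + 3)²`:  `D(u;s)[N] = Σ_{m ≤ N} Σ_η x_c^m · Irr_{≤ s}(u + η m)[N]`,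
`η` ranging over the record-ending `m`-step walks from `u` confined to the open disc of radius
`dist (Site.toComplex u) z` after time `0` with end radius `> s` (`m = 0`: the trivial walk), and
`Irr_{≤ s}(w)[N]` the mass of the radially irreducible descents from `w` of length `≤ N` (confined
to the open disc of radius `dist (Site.toComplex w) z` after time `0`, end = strict record of
radius `≤ dist (Site.toComplex w) z`, no radial renewal time before the end at all) with end
radius `≤ s` — the line's skip family from `w` at `A = 1`, its level written without `/ 1`.
`rr_lr_cut_identity` with `Q = (· ≤ s)`. [folklore] -/
theorem rr_lr_lastRenewal_identity :
    ∀ (z : ℂ) (u : Site 2) (s : ℝ) (N : ℕ), s < dist (Site.toComplex u) z →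
      (2 * ⌈dist (Site.toComplex u) z⌉₊ + 3) ^ 2 ≤ N →
      (∑ n ∈ Finset.range (N + 1),
        ∑ _ω ∈ (SAW.Zd.saws 2 n).filter (fun ω =>
          0 < n ∧
          (∀ i, 0 < i → i ≤ n → dist (Site.toComplex (u + ω i)) z < dist (Site.toComplex u) z) ∧
          (∀ i, i < n → dist (Site.toComplex (u + ω n)) z < dist (Site.toComplex (u + ω i)) z) ∧
          dist (Site.toComplex (u + ω n)) z ≤ s ∧
          (∀ t, 0 < t → t < n →
            (∀ i, i < t → dist (Site.toComplex (u + ω t)) z < dist (Site.toComplex (u + ω i)) z) →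
            (∀ j, t < j → j ≤ n → dist (Site.toComplex (u + ω j)) z < dist (Site.toComplex (u + ω t)) z) →
            s < dist (Site.toComplex (u + ω t)) z)),
          SAW.criticalFugacity ^ n) =
      ∑ m ∈ Finset.range (N + 1),
        ∑ η ∈ (SAW.Zd.saws 2 m).filter (fun η =>
            s < dist (Site.toComplex (u + η m)) z ∧
            (∀ i, 0 < i → i ≤ m → dist (Site.toComplex (u + η i)) z < dist (Site.toComplex u) z) ∧
            (∀ i, i < m → dist (Site.toComplex (u + η m)) z < dist (Site.toComplex (u + η i)) z)),
          SAW.criticalFugacity ^ m *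
            (∑ k ∈ Finset.range (N + 1),
              ∑ _τ ∈ (SAW.Zd.saws 2 k).filter (fun τ =>
                dist (Site.toComplex (u + η m + τ k)) z ≤ s ∧
                0 < k ∧
                (∀ i, 0 < i → i ≤ k →
                  dist (Site.toComplex (u + η m + τ i)) z < dist (Site.toComplex (u + η m)) z) ∧
                (∀ i, i < k →
                  dist (Site.toComplex (u + η m + τ k)) z < dist (Site.toComplex (u + η m + τ i)) z) ∧
                dist (Site.toComplex (u + η m + τ k)) z ≤ dist (Site.toComplex (u + η m)) z ∧
                (∀ t, 0 < t → t < k →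
                  (∀ i, i < t →
                    dist (Site.toComplex (u + η m + τ t)) z < dist (Site.toComplex (u + η m + τ i)) z) →
                  (∀ j, t < j → j ≤ k →
                    dist (Site.toComplex (u + η m + τ j)) z < dist (Site.toComplex (u + η m + τ t)) z) →
                  dist (Site.toComplex (u + η m)) z < dist (Site.toComplex (u + η m + τ t)) z)),
                SAW.criticalFugacity ^ k) := by
  intro z u s N hs hN
  convert rr_lr_cut_identity (· ≤ s) z u s N hs hN using 0

/-! ### The mass balance of the radial renewal chain -/

/-- Splitting a filtered sum by a further predicate `p`, its negation given in an equivalent form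
`p'`. [folklore] -/
theorem rr_lr_sum_filter_split {β : Type*} (S : Finset β) (p p' q : β → Prop) (f : β → ℝ)
    {iq : DecidablePred q} {ipq : DecidablePred fun b => p b ∧ q b}
    {ip'q : DecidablePred fun b => p' b ∧ q b} (hp' : ∀ b, p' b ↔ ¬ p b) :
    ∑ b ∈ S.filter q, f b =
      ∑ b ∈ S.filter (fun b => p b ∧ q b), f b + ∑ b ∈ S.filter (fun b => p' b ∧ q b), f b := by
  classical
  rw [← Finset.sum_filter_add_sum_filter_not (S.filter q) p, Finset.filter_filter,
    Finset.filter_filter]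
  congr 1
  · exact Finset.sum_congr (Finset.filter_congr fun b _ => and_comm) fun _ _ => rfl
  · exact Finset.sum_congr (Finset.filter_congr fun b _ => by rw [and_comm, hp']) fun _ _ => rfl

/-- The bookkeeping of the mass balance: if `D = Σ a·I₁`, `B = Σ a·I₂`, `Σ a = 1 + B` and
`K = I₁ + I₂` termwise, then `D = 1 + Σ a·(K - 1)`. [folklore] -/
theorem rr_lr_balance_algebra {β : Type*} (R : Finset ℕ) (T : ℕ → Finset β) (a : ℕ → ℝ)
    (I₁ I₂ K : ℕ → β → ℝ) {D B : ℝ}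
    (h1 : D = ∑ m ∈ R, ∑ η ∈ T m, a m * I₁ m η) (h2 : B = ∑ m ∈ R, ∑ η ∈ T m, a m * I₂ m η)
    (h3 : ∑ m ∈ R, ∑ _η ∈ T m, a m = 1 + B) (hK : ∀ m, ∀ η ∈ T m, K m η = I₁ m η + I₂ m η) :
    D = 1 + ∑ m ∈ R, ∑ η ∈ T m, a m * (K m η - 1) := by
  have e : ∀ m ∈ R, ∑ η ∈ T m, a m * (K m η - 1) =
      ∑ η ∈ T m, a m * I₁ m η + ∑ η ∈ T m, a m * I₂ m η - ∑ _η ∈ T m, a m := by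
    intro m _
    rw [← Finset.sum_add_distrib, ← Finset.sum_sub_distrib]
    refine Finset.sum_congr rfl fun η hη => ?_
    rw [hK m η hη]
    ring
  rw [Finset.sum_congr rfl e, Finset.sum_sub_distrib, Finset.sum_add_distrib, ← h1, ← h2, h3]
  ring

/-- **The trivial prefix.** Among the record-ending confined prefixes from `u` with end radius
`> s` (`s < dist (Site.toComplex u) z`), those of length `0` — the trivial walk alone — have mass
`1`, and those of positive length are exactly the walks counted by `rr_lr_cut_identity` with
`Q = (s < ·)` (their renewal times are automatically at radius `> s`). [folklore] -/
theorem rr_lr_prefix_split (z : ℂ) (u : Site 2) (s : ℝ) (N : ℕ)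
    (hs : s < dist (Site.toComplex u) z) :
    (∑ m ∈ Finset.range (N + 1),
      ∑ _η ∈ (SAW.Zd.saws 2 m).filter (fun η =>
          s < dist (Site.toComplex (u + η m)) z ∧
          (∀ i, 0 < i → i ≤ m → dist (Site.toComplex (u + η i)) z < dist (Site.toComplex u) z) ∧
          (∀ i, i < m → dist (Site.toComplex (u + η m)) z < dist (Site.toComplex (u + η i)) z)),
        SAW.criticalFugacity ^ m) =
    1 + ∑ n ∈ Finset.range (N + 1),
      ∑ _ω ∈ (SAW.Zd.saws 2 n).filter (fun ω =>
        0 < n ∧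
        (∀ i, 0 < i → i ≤ n → dist (Site.toComplex (u + ω i)) z < dist (Site.toComplex u) z) ∧
        (∀ i, i < n → dist (Site.toComplex (u + ω n)) z < dist (Site.toComplex (u + ω i)) z) ∧
        s < dist (Site.toComplex (u + ω n)) z ∧
        (∀ t, 0 < t → t < n →
          (∀ i, i < t → dist (Site.toComplex (u + ω t)) z < dist (Site.toComplex (u + ω i)) z) →
          (∀ j, t < j → j ≤ n → dist (Site.toComplex (u + ω j)) z < dist (Site.toComplex (u + ω t)) z) →
          s < dist (Site.toComplex (u + ω t)) z)),
        SAW.criticalFugacity ^ n := by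
  rw [Finset.sum_range_succ', Finset.sum_range_succ']
  have h0 : ∀ η ∈ SAW.Zd.saws 2 0,
      s < dist (Site.toComplex (u + η 0)) z ∧
      (∀ i, 0 < i → i ≤ 0 → dist (Site.toComplex (u + η i)) z < dist (Site.toComplex u) z) ∧
      (∀ i, i < 0 → dist (Site.toComplex (u + η 0)) z < dist (Site.toComplex (u + η i)) z) := by
    intro η hη
    refine ⟨?_, fun i hi hi0 => by omega, fun i hi => by omega⟩
    rw [(SAW.Zd.mem_saws.1 hη).1, add_zero]
    exact hs
  rw [Finset.filter_true_of_mem h0, Finset.sum_const, SAW.Zd.card_saws, SAW.Zd.count_zero,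
    pow_zero, one_smul, Finset.filter_false_of_mem (fun η _ h => lt_irrefl 0 h.1),
    Finset.sum_empty, add_zero, add_comm]
  congr 1
  refine Finset.sum_congr rfl fun m _ => Finset.sum_congr (Finset.filter_congr fun η _ => ?_)
    fun _ _ => rfl
  constructor
  · rintro ⟨hsm, hconf, hend⟩
    exact ⟨Nat.succ_pos m, hconf, hend, hsm, fun t _ ht _ _ => hsm.trans (hend t ht)⟩
  · rintro ⟨-, hconf, hend, hsm, -⟩
    exact ⟨hsm, hconf, hend⟩

/-- **The mass balance of the radial renewal chain** (registered helper `rr_lr_mass_balance` for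
`stub_deathSeed`).  For a centre `z`, a start `u`, a level `s < dist (Site.toComplex u) z` and
`N ≥ (2⌈dist (Site.toComplex u) z⌉₊ + 3)²`:
`D(u;s)[N] = 1 + Σ_{m ≤ N} Σ_η x_c^m · (k(u + η m)[N] - 1)`, `η` over the record-ending `m`-step
walks from `u` confined to the open disc of radius `dist (Site.toComplex u) z` after time `0` with
end radius `> s` (`m = 0` allowed), `k(w)[N]` the mass of ALL radially irreducible descents from
`w` of length `≤ N` (the level-`dist (Site.toComplex w) z` chain-stopped family from `w`).  Proof:
the last-renewal identity (`Q = (· ≤ s)`), the renewal equation of the record-ending prefixes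
(`rr_lr_cut_identity`, `Q = (s < ·)`, with `rr_lr_prefix_split`), and `k = Irr_{≤ s} + Irr_{> s}`.
So the death seed S2 is a statement about the accumulated deficits `1 - k(w)` along the chain.
[folklore] -/
theorem rr_lr_mass_balance :
    ∀ (z : ℂ) (u : Site 2) (s : ℝ) (N : ℕ), s < dist (Site.toComplex u) z →
      (2 * ⌈dist (Site.toComplex u) z⌉₊ + 3) ^ 2 ≤ N →
      (∑ n ∈ Finset.range (N + 1),
        ∑ _ω ∈ (SAW.Zd.saws 2 n).filter (fun ω =>
          0 < n ∧
          (∀ i, 0 < i → i ≤ n → dist (Site.toComplex (u + ω i)) z < dist (Site.toComplex u) z) ∧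
          (∀ i, i < n → dist (Site.toComplex (u + ω n)) z < dist (Site.toComplex (u + ω i)) z) ∧
          dist (Site.toComplex (u + ω n)) z ≤ s ∧
          (∀ t, 0 < t → t < n →
            (∀ i, i < t → dist (Site.toComplex (u + ω t)) z < dist (Site.toComplex (u + ω i)) z) →
            (∀ j, t < j → j ≤ n → dist (Site.toComplex (u + ω j)) z < dist (Site.toComplex (u + ω t)) z) →
            s < dist (Site.toComplex (u + ω t)) z)),
          SAW.criticalFugacity ^ n) =
      1 + ∑ m ∈ Finset.range (N + 1),
        ∑ η ∈ (SAW.Zd.saws 2 m).filter (fun η =>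
            s < dist (Site.toComplex (u + η m)) z ∧
            (∀ i, 0 < i → i ≤ m → dist (Site.toComplex (u + η i)) z < dist (Site.toComplex u) z) ∧
            (∀ i, i < m → dist (Site.toComplex (u + η m)) z < dist (Site.toComplex (u + η i)) z)),
          SAW.criticalFugacity ^ m *
            ((∑ k ∈ Finset.range (N + 1),
              ∑ _τ ∈ (SAW.Zd.saws 2 k).filter (fun τ =>
                0 < k ∧
                (∀ i, 0 < i → i ≤ k →
                  dist (Site.toComplex (u + η m + τ i)) z < dist (Site.toComplex (u + η m)) z) ∧
                (∀ i, i < k →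
                  dist (Site.toComplex (u + η m + τ k)) z < dist (Site.toComplex (u + η m + τ i)) z) ∧
                dist (Site.toComplex (u + η m + τ k)) z ≤ dist (Site.toComplex (u + η m)) z ∧
                (∀ t, 0 < t → t < k →
                  (∀ i, i < t →
                    dist (Site.toComplex (u + η m + τ t)) z < dist (Site.toComplex (u + η m + τ i)) z) →
                  (∀ j, t < j → j ≤ k →
                    dist (Site.toComplex (u + η m + τ j)) z < dist (Site.toComplex (u + η m + τ t)) z) →
                  dist (Site.toComplex (u + η m)) z < dist (Site.toComplex (u + η m + τ t)) z)),
                SAW.criticalFugacity ^ k) - 1) := by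
  intro z u s N hs hN
  have h2 : (∑ n ∈ Finset.range (N + 1),
      ∑ _ω ∈ (SAW.Zd.saws 2 n).filter (fun ω =>
        0 < n ∧
        (∀ i, 0 < i → i ≤ n → dist (Site.toComplex (u + ω i)) z < dist (Site.toComplex u) z) ∧
        (∀ i, i < n → dist (Site.toComplex (u + ω n)) z < dist (Site.toComplex (u + ω i)) z) ∧
        s < dist (Site.toComplex (u + ω n)) z ∧
        (∀ t, 0 < t → t < n →
          (∀ i, i < t → dist (Site.toComplex (u + ω t)) z < dist (Site.toComplex (u + ω i)) z) →
          (∀ j, t < j → j ≤ n → dist (Site.toComplex (u + ω j)) z < dist (Site.toComplex (u + ω t)) z) →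
          s < dist (Site.toComplex (u + ω t)) z)),
        SAW.criticalFugacity ^ n) =
    ∑ m ∈ Finset.range (N + 1),
      ∑ η ∈ (SAW.Zd.saws 2 m).filter (fun η =>
          s < dist (Site.toComplex (u + η m)) z ∧
          (∀ i, 0 < i → i ≤ m → dist (Site.toComplex (u + η i)) z < dist (Site.toComplex u) z) ∧
          (∀ i, i < m → dist (Site.toComplex (u + η m)) z < dist (Site.toComplex (u + η i)) z)),
        SAW.criticalFugacity ^ m *
          (∑ k ∈ Finset.range (N + 1),
            ∑ _τ ∈ (SAW.Zd.saws 2 k).filter (fun τ =>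
              s < dist (Site.toComplex (u + η m + τ k)) z ∧
              0 < k ∧
              (∀ i, 0 < i → i ≤ k →
                dist (Site.toComplex (u + η m + τ i)) z < dist (Site.toComplex (u + η m)) z) ∧
              (∀ i, i < k →
                dist (Site.toComplex (u + η m + τ k)) z < dist (Site.toComplex (u + η m + τ i)) z) ∧
              dist (Site.toComplex (u + η m + τ k)) z ≤ dist (Site.toComplex (u + η m)) z ∧
              (∀ t, 0 < t → t < k →
                (∀ i, i < t →
                  dist (Site.toComplex (u + η m + τ t)) z < dist (Site.toComplex (u + η m + τ i)) z) →
                (∀ j, t < j → j ≤ k →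
                  dist (Site.toComplex (u + η m + τ j)) z < dist (Site.toComplex (u + η m + τ t)) z) →
                dist (Site.toComplex (u + η m)) z < dist (Site.toComplex (u + η m + τ t)) z)),
              SAW.criticalFugacity ^ k) := by
    convert rr_lr_cut_identity (s < ·) z u s N hs hN using 0
  exact rr_lr_balance_algebra (Finset.range (N + 1)) _ (fun m => SAW.criticalFugacity ^ m) _ _ _
    (rr_lr_lastRenewal_identity z u s N hs hN) h2 (rr_lr_prefix_split z u s N hs)
    fun m η _ => by
      rw [← Finset.sum_add_distrib]
      exact Finset.sum_congr rfl fun k _ => rr_lr_sum_filter_split _ _ _ _ _ fun _ => not_le.symm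

end Summit.CriticalPhenomena.SAWScalingLimit.Theorems.AnnularMassDecay.Radial

end
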